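import Mathlib.Combinatorics.Additive.Energy
import Mathlib.Algebra.Order.Chebyshev
import Mathlib.Data.Real.Basic
import Mathlib.Tactic
import HarnessLib

/-!
# Route `GreenTaoLevelTwo`, crux `GITwo` (stmt-Parity-21275), line `birth`, stub `stub_cyclicInverse`:
# towards Balog–Szemerédi–Gowers — popular sums carry the additive energy

Fifth helper file toward the XL stub `stub_cyclicInverse` (B. Green, T. Tao, arXiv:math/0503014,
Thm. 68 = PEMS 51 (2008) Thm. 12.8), continuing the Balog–Szemerédi–Gowers brick (arXiv Thm. 25;
sibling file `…CyclicInverseBSGPaths` = dependent random choice).  The BSG argument begins by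
converting large additive energy `E(A) ≥ |A|³/K` (Mathlib's `Finset.addEnergy`) into a dense
bipartite **popular-sum graph**: `(a, b) ∈ A × A` is an edge iff `a + b` is a *popular sum*, i.e.
has at least `|A|/(2K)` representations.  This def-free file lands that conversion for a finite
subset `A` of any additive commutative group:

* `sum_repr_eq_card_sq` — `∑_{x ∈ A+A} r(x) = #A²`, `r(x) = #{(a,b) ∈ A² : a + b = x}`;
* `repr_le_card` — `r(x) ≤ #A`;
* `sum_sq_repr_unpopular_le` — the unpopular sums carry energy `≤ #A³/(2K)`;
* `sum_sq_repr_popular_ge` — the popular sums carry energy `≥ E(A) − #A³/(2K)`;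
* `card_popularEdges_ge` — **if `E(A) ≥ #A³/K` then the popular-sum graph has `≥ #A²/(2K)` edges**,
  each popular sum having `≥ #A/(2K)` representations (by definition).

Together with `exists_vertex_many_rich_pairs` (paths of length two) this is the input of the
paths-of-length-three step and of the final `6`-tuple count of BSG (next files, not here).

References: [GreenTao2008U3Inverse] arXiv:math/0503014 Thm. 25; W. T. Gowers, GAFA 8 (1998) §7;
T. Tao, V. Vu, *Additive Combinatorics* (CUP 2006), §2.5.
-/

namespace Summit.Parity.GeneralizedHardyLittlewood.GreenTaoLevelTwoGITwoCyclicInverse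

open Finset
open scoped Pointwise Combinatorics.Additive

variable {G : Type*} [AddCommGroup G] [DecidableEq G]

/-- The representation counts of `A + A` add up to `#A²`: `∑_{x ∈ A+A} r(x) = #(A × A)`. [folklore] -/
theorem sum_repr_eq_card_sq (A : Finset G) :
    ∑ x ∈ A + A, #{p ∈ A ×ˢ A | p.1 + p.2 = x} = #A * #A := by
  rw [← card_product]
  exact (card_eq_sum_card_fiberwise fun p hp =>
    add_mem_add (mem_product.mp hp).1 (mem_product.mp hp).2).symm

/-- Each sum has at most `#A` representations: `r(x) ≤ #A`. [folklore] -/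
theorem repr_le_card (A : Finset G) (x : G) : #{p ∈ A ×ˢ A | p.1 + p.2 = x} ≤ #A := by
  refine Finset.card_le_card_of_injOn (fun p => p.1) ?_ ?_
  · intro p hp
    rw [mem_coe, mem_filter, mem_product] at hp
    exact hp.1.1
  · intro p hp p' hp' h
    rw [mem_coe, mem_filter] at hp hp'
    have h1 : p.1 = p'.1 := h
    have h2 : p.2 = p'.2 := by
      have := hp.2.trans hp'.2.symm
      rw [h1] at this
      exact add_left_cancel this
    exact Prod.ext h1 h2

/-- The unpopular sums (fewer than `#A/(2K)` representations) carry little energy: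
`∑_{x unpopular} r(x)² ≤ #A³/(2K)`. [cite: GreenTao2008U3Inverse, Thm. 25 (proof, first step)] -/
theorem sum_sq_repr_unpopular_le (A : Finset G) {K : ℝ} (hK : 0 < K) :
    ∑ x ∈ (A + A).filter (fun x => ((#{p ∈ A ×ˢ A | p.1 + p.2 = x} : ℕ) : ℝ) < #A / (2 * K)),
        ((#{p ∈ A ×ˢ A | p.1 + p.2 = x} : ℕ) : ℝ) ^ 2 ≤ (#A : ℝ) ^ 3 / (2 * K) := by
  have hA0 : (0 : ℝ) ≤ #A / (2 * K) := by positivity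
  calc ∑ x ∈ (A + A).filter (fun x => ((#{p ∈ A ×ˢ A | p.1 + p.2 = x} : ℕ) : ℝ) < #A / (2 * K)),
        ((#{p ∈ A ×ˢ A | p.1 + p.2 = x} : ℕ) : ℝ) ^ 2
      ≤ ∑ x ∈ (A + A).filter (fun x => ((#{p ∈ A ×ˢ A | p.1 + p.2 = x} : ℕ) : ℝ) < #A / (2 * K)),
          (#A : ℝ) / (2 * K) * ((#{p ∈ A ×ˢ A | p.1 + p.2 = x} : ℕ) : ℝ) := by
        refine sum_le_sum fun x hx => ?_
        have hlt := (mem_filter.mp hx).2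
        rw [sq]
        exact mul_le_mul_of_nonneg_right hlt.le (Nat.cast_nonneg _)
    _ ≤ ∑ x ∈ A + A, (#A : ℝ) / (2 * K) * ((#{p ∈ A ×ˢ A | p.1 + p.2 = x} : ℕ) : ℝ) :=
        sum_le_sum_of_subset_of_nonneg (filter_subset _ _) fun x _ _ => by positivity
    _ = (#A : ℝ) / (2 * K) * ((#A : ℝ) * #A) := by
        rw [← mul_sum]
        congr 1
        exact_mod_cast sum_repr_eq_card_sq A
    _ = (#A : ℝ) ^ 3 / (2 * K) := by ring

/-- The popular sums (`≥ #A/(2K)` representations) carry almost all the energy: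
`∑_{x popular} r(x)² ≥ E(A) − #A³/(2K)`. [cite: GreenTao2008U3Inverse, Thm. 25 (proof, first step)] -/
theorem sum_sq_repr_popular_ge (A : Finset G) {K : ℝ} (hK : 0 < K) :
    (E[A, A] : ℝ) - (#A : ℝ) ^ 3 / (2 * K) ≤
      ∑ x ∈ (A + A).filter (fun x => (#A : ℝ) / (2 * K) ≤ ((#{p ∈ A ×ˢ A | p.1 + p.2 = x} : ℕ) : ℝ)),
        ((#{p ∈ A ×ˢ A | p.1 + p.2 = x} : ℕ) : ℝ) ^ 2 := by
  have hE : (E[A, A] : ℝ) = ∑ x ∈ A + A, ((#{p ∈ A ×ˢ A | p.1 + p.2 = x} : ℕ) : ℝ) ^ 2 := by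
    rw [addEnergy_eq_sum_sq']
    push_cast
    rfl
  have hsplit := Finset.sum_filter_add_sum_filter_not (A + A)
    (fun x => (#A : ℝ) / (2 * K) ≤ ((#{p ∈ A ×ˢ A | p.1 + p.2 = x} : ℕ) : ℝ))
    (fun x => ((#{p ∈ A ×ˢ A | p.1 + p.2 = x} : ℕ) : ℝ) ^ 2)
  have hneg : (A + A).filter (fun x => ¬ (#A : ℝ) / (2 * K) ≤ ((#{p ∈ A ×ˢ A | p.1 + p.2 = x} : ℕ) : ℝ)) =
      (A + A).filter (fun x => ((#{p ∈ A ×ˢ A | p.1 + p.2 = x} : ℕ) : ℝ) < #A / (2 * K)) :=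
    filter_congr fun x _ => not_le
  rw [hneg] at hsplit
  have hun := sum_sq_repr_unpopular_le A hK
  rw [hE, ← hsplit]
  linarith

/-- **Popular sums graph is dense.** If `E(A) ≥ #A³/K` then the bipartite graph on `A × A` whose
edges are the pairs with a popular sum (`≥ #A/(2K)` representations) has at least `#A²/(2K)` edges.
[cite: GreenTao2008U3Inverse, Thm. 25 (proof, first step)] -/
theorem card_popularEdges_ge (A : Finset G) {K : ℝ} (hK : 0 < K)
    (hEA : (#A : ℝ) ^ 3 / K ≤ (E[A, A] : ℝ)) :
    (#A : ℝ) ^ 2 / (2 * K) ≤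
      #{p ∈ A ×ˢ A | p.1 + p.2 ∈ (A + A).filter
        (fun x => (#A : ℝ) / (2 * K) ≤ ((#{q ∈ A ×ˢ A | q.1 + q.2 = x} : ℕ) : ℝ))} := by
  set P := (A + A).filter
    (fun x => (#A : ℝ) / (2 * K) ≤ ((#{q ∈ A ×ˢ A | q.1 + q.2 = x} : ℕ) : ℝ)) with hP
  -- the number of popular edges is `∑_{x ∈ P} r(x)`
  have hedges : #{p ∈ A ×ˢ A | p.1 + p.2 ∈ P} = ∑ x ∈ P, #{q ∈ A ×ˢ A | q.1 + q.2 = x} := by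
    rw [card_eq_sum_card_fiberwise (f := fun p : G × G => p.1 + p.2)
      (s := {p ∈ A ×ˢ A | p.1 + p.2 ∈ P}) (t := P)
      (fun p hp => by
        have hp' : p ∈ {p ∈ A ×ˢ A | p.1 + p.2 ∈ P} := hp
        exact (mem_filter.mp hp').2)]
    refine sum_congr rfl fun x hx => ?_
    congr 1
    ext q
    simp only [mem_filter, mem_product]
    constructor
    · rintro ⟨⟨hq, -⟩, hqx⟩; exact ⟨hq, hqx⟩
    · rintro ⟨hq, hqx⟩; exact ⟨⟨hq, by rw [hqx]; exact hx⟩, hqx⟩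
  rcases A.eq_empty_or_nonempty with hA | hA
  · simp [hA]
  have hApos : (0 : ℝ) < #A := by exact_mod_cast hA.card_pos
  -- `∑_{x∈P} r(x)² ≤ #A ∑_{x∈P} r(x)`
  have h1 : ∑ x ∈ P, ((#{q ∈ A ×ˢ A | q.1 + q.2 = x} : ℕ) : ℝ) ^ 2 ≤
      (#A : ℝ) * ∑ x ∈ P, ((#{q ∈ A ×ˢ A | q.1 + q.2 = x} : ℕ) : ℝ) := by
    rw [mul_sum]
    refine sum_le_sum fun x _ => ?_
    rw [sq]
    exact mul_le_mul_of_nonneg_right (by exact_mod_cast repr_le_card A x) (Nat.cast_nonneg _)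
  have h2 := sum_sq_repr_popular_ge A hK
  rw [← hP] at h2
  have h3 : (#A : ℝ) ^ 3 / (2 * K) ≤ (#A : ℝ) * ∑ x ∈ P, ((#{q ∈ A ×ˢ A | q.1 + q.2 = x} : ℕ) : ℝ) := by
    have : (#A : ℝ) ^ 3 / K - (#A : ℝ) ^ 3 / (2 * K) = (#A : ℝ) ^ 3 / (2 * K) := by ring
    linarith
  rw [hedges]
  push_cast
  have h4 : (#A : ℝ) ^ 2 / (2 * K) * #A ≤ (∑ x ∈ P, ((#{q ∈ A ×ˢ A | q.1 + q.2 = x} : ℕ) : ℝ)) * #A := by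
    calc (#A : ℝ) ^ 2 / (2 * K) * #A = (#A : ℝ) ^ 3 / (2 * K) := by ring
      _ ≤ _ := h3
      _ = _ := mul_comm _ _
  exact le_of_mul_le_mul_right h4 hApos

end Summit.Parity.GeneralizedHardyLittlewood.GreenTaoLevelTwoGITwoCyclicInverse
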